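import Mathlib.FieldTheory.IsAlgClosed.Basic
import Mathlib.Algebra.Polynomial.Roots
import Mathlib.RepresentationTheory.Subrepresentation
import Mathlib.RepresentationTheory.Intertwining
import Mathlib.RepresentationTheory.Irreducible
import Literature.Computability.AlgebraicComplexity.GCTObstructions
import Literature.Computability.AlgebraicComplexity.Polystability
import Literature.Computability.AlgebraicComplexity.PolystabilityProofs
import Literature.Computability.AlgebraicComplexity.CharacterizedByStabilizerSL
import Literature.Computability.AlgebraicComplexity.MultiplicityObstructionsProofs
import Literature.Computability.AlgebraicComplexity.OrbitClosureProofs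
import Literature.Computability.AlgebraicComplexity.PermanentVsDeterminantProofs
import Literature.Computability.AlgebraicComplexity.DeterminantalComplexityProofs
import Literature.Computability.AlgebraicComplexity.StandardFamiliesProofs
import Literature.Computability.AlgebraicComplexity.GrenetEquivariant
import Literature.Computability.AlgebraicComplexity.BLMW11StabilityInheritance
import Literature.Computability.AlgebraicComplexity.BIPNoOccurrenceProofs
import Literature.NumberTheory.DiophantineGeometry.GLHighestWeight
import Literature.RingTheory.MvPolynomial.BihomogeneousCoefficients
import HarnessLib

/-!
# Mulmuley–Sohoni, GCT II (SIAM J. Comput. 38, 2008), §1–§5: class varieties, obstructions,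
# stability, excellence, admissibility — typed as printed, in the tree's vocabulary

Typed literature for cell `val-lit` (DAG row MS08-A; typer `val-lit-t02`); honest framing of that
cell: bookkeeping of published statements; VP ≠ VNP is NOT proved and nothing here is progress on
it; (per, det) at small parameters = method validation at a known separation.

SOURCE. K. D. Mulmuley, M. Sohoni, *Geometric complexity theory II: towards explicit obstructions
for embeddings among class varieties*, SIAM J. Comput. 38 (2008) 1175–1206 = arXiv:cs/0612134
[MulmuleySohoniGCT2SIAM2008]. Locators: JOURNAL numbering (Def. 1.2 = obstruction, Thm. 1.8 =
Borel–Weil, Thm. 2.3, Prop. 4.2, Props. 5.1–5.2), which is the e-print's numbering minus one in the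
section (the e-print numbers its abstract as §1), and TeX lines `[Lnnn]` of the e-print source
`main.tex` (3737 lines, held as `pub-gct/inputs/files/src/cs_0612134/main.tex`). This file covers
journal §1 "Main results" `[L127–684]`, §2 "The orbit closure problem" `[L685–892]`, §3 "Why should
obstructions exist?" `[L893–989]`, §4 "Admissibility" `[L990–1094]`, §5 "Admissibility and
stability" `[L1095–1174]`; §6–§12 (SFT for excellent points, partial stability, Borel–Weil with
parabolic data, `G`-separability) are the companion row MS08-B.

SETTING AND DICTIONARY. MS: "All groups in this paper are algebraic and the base field is `ℂ`. Let
`G` be a connected, reductive group, `V` its (finite dimensional) linear representation … Let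
`Δ_V[v]` denote the projective closure of the `G`-orbit of `v` in `P(V)` … `R_V[v]` its homogeneous
coordinate ring, `I_V[v]` its ideal, and `R_V[v]_d` the degree `d` component" `[L133–145]`; the
running example is `V = Sym^m(Y)`, `Y` an `m × m` variable matrix, "with the natural action of
`G = SL(Y) = SL_l(ℂ)`, and `Ĝ = GL(Y) = GL_l(ℂ)`", `g = det(Y)` `[L190–200, L690–697]`. The tree
speaks exactly this example, for ANY form: forms are `MvPolynomial σ k`, `Ĝ = GL σ k` acts by
linear substitution `linSubstRep` (`LinSubst.lean`), `G = SL` is the subgroup `slSubgroup σ k`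
(`CharacterizedByStabilizerSL.lean`), the affine cone over `Δ_V[v]` is `orbitClosure v`
(`OrbitClosure.lean`; over `ℂ` the `SL`- and `GL`-orbits of the point `[v] ∈ P(V)` agree,
`hasFullProjectiveOrbit_slSubgroup` below, and Zariski = Euclidean closure,
`orbitClosure_eq_euclidean_closure_complex_holds`), `R_V[v] = k[Δ[v]]` is `OrbitCoordRing v m` with
`G`-action `orbitCoordRep v m` and degree pieces `orbitCoordRingDeg v m d` / `orbitCoordRepDeg`
(`OrbitCoordinateRing.lean`, `GCTObstructions.lean`), `I_V[v]` is `orbitVanishingIdeal v m`,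
`G_v̂` is `G ⊓ linStabilizer v` (`EquivariantDC.lean`), MS's `f = φ(perm) = y^{m-n} perm(X)` is
`paddedPerPoly k n m` (`OrbitClosure.lean`), "stable" is `IsPolystable` (`Polystability.lean`).
Statements more general than this setting (arbitrary reductive `G`, arbitrary `V`) are typed in
the special case and marked `TODO(general form)`.

## Crosswalk §1–§5 (every numbered item; CITE = already in the tree, NEW = this file)

§1 Main results (e-print §2)
* Problem 1.1 `[pintroorbit, L154–161]` "Given explicit points `f, g ∈ P(V)`, does `f ∈ Δ_V[g]`?"
  — a problem, not a statement: CITE `orbitClosure`, `HasBorderDetRepr` (per/det instance).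
* "characterized by its stabilizer" `[L221–231]` — CITE `IsCharacterizedByStabilizerIn`,
  `fixedForms`, `IsCharacterizedByStabilizer` (`CharacterizedByStabilizer.lean`); det/per/padded per
  PROVED there in the `GL` reading, `SL` reading PROVED for det and padded per and decided for per
  (`isCharacterizedByStabilizerIn_slSubgroup_perPoly_iff`: iff `n ≢ 1 (mod 4)`).
* "stable", "semistable", "null cone" `[L233–240]` — stable: CITE `IsPolystable`; NEW
  `IsSLSemistable`, `InNullCone` (as printed, via invariant polynomial functions on `Sym^m`), with
  `inNullCone_of_zero_mem_zariskiClosure_slOrbit` (elementary half of the Hilbert–Mumford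
  description) and `IsPolystable.isSLSemistable` PROVED.
* "partially stable with defect zero / `(L,P)`-stable" `[L241–258]` (Kempf's canonical
  destabilizing flag) — NOT TYPED: Kempf's optimal one-parameter subgroups / parabolic–Levi data are
  absent from Mathlib and the tree (FACT-LIST R1); Def. 2.1's special case is definitional (below).
* "excellent" `[L263–268]` — NEW `IsStableExcellent` (the stable branch; TODO(general form) for the
  defect-zero branch), with `isStableExcellent_detPoly`, `isStableExcellent_perPoly_iff` (ERRATUM-
  GRADE: in the literal `G = SL(X)` reading `per_n` is excellent iff `n ≢ 1 (mod 4)`),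
  `not_isStableExcellent_perPoly_five`, `isPolystable_and_isCharacterizedByStabilizer_perPoly`
  (`Ĝ = GL` reading, all `n`), `not_isStableExcellent_paddedPerPoly` PROVED.
* highest weight vector is excellent, `Δ_V[v] ≅ G/P` `[L269–277]`; SFT / Borel–Weil for `G/P`
  `[L419–426]`; Luna–Vust complexity `[L434–450]` — NOT TYPED (flag varieties; classical results
  of [fulton, smt], not MS's).
* the mechanism `[L291–301]` ("degree preserving `G`-equivariant surjection from `R_V[g]` to
  `R_V[f]` … multiplicity in `R_V[g]_d` exceeds that in `R_V[f]_d`") — CITE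
  `not_hasMultiplicityObstruction_of_mem_orbitClosure` (PROVED, `GCTObstructions.lean`),
  `orbitMultiplicity_le_of_mem_orbitClosure_holds`.
* **Def. 1.2** obstruction `[dobst1, L302–310]` — CITE `HasOccurrenceObstruction` (degree form),
  `IsOccurrenceObstructionAt` (weight form, `ObstructionTypes.lean`), `HasMultiplicityObstruction`.
* "Existence of such an `S` implies that `f` cannot lie in `Δ_V[g]`" `[L312–313]` — CITE
  `not_mem_orbitClosure_of_isMultiplicityObstructionAt`; NEW `HasStrongObstruction.not_mem_orbitClosure`.
* **Def. 1.3** strong obstruction `[dobst2, L323–333]` — NEW `HasStrongObstruction` (with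
  `IsEvalSemiInvariant` = "`S^*` contains a `G_g`-module isomorphic to `(ℂg)^d`"); the per/det
  `sk`-form is CITE `isOccurrenceObstructionAt_perDet_of_symKroneckerCoeffRect_eq_zero`
  (`PerDetObstructionKinds.lean`).
* "A strong obstruction is also an obstruction" `[L332]` — NEW PROVED
  `HasStrongObstruction.hasOccurrenceObstruction` (via Prop. 4.2).
* Problems 1.4–1.7 `[pintroexplicit L354–359; pintrosubgroup L366–372; pintrogit1 L393–399;
  pintrogit2 L405–410]` — problems, not statements: the Kronecker / plethysm coefficients they ask
  for are CITE `Literature.NumberTheory.DiophantineGeometry.kroneckerCoeff`, `symKroneckerCoeffRect`,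
  `plethysmCoeff`; "explicit decomposition of `R_V[v]_d`" = `orbitMultiplicity`.
* "`G_v̂`-admissible" `[L474–475]` — CITE `IsAdmissible` (`BLMW11StabilityInheritance.lean`, Def. 4.1).
* **Thm. 1.8** `[tlieovernew, L478–497]` (Borel–Weil for orbit closures): (a) — NEW NAMED FACT
  `MS08_thm_1_8a` (special case `G = SL_σ(ℂ)`, `V = Sym^m`; R1: Matsushima + algebraic
  Peter–Weyl), with the projection `MS08_prop_5_2_of_thm_1_8a`; (b) and its precise forms
  Thms. 8.1–8.2 — row MS08-B (CITE the special cases PROVED in `OrbitClosureInheritance.lean`).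
* `Π_v`, `X(Π_v)`, `Δ_V[v] ⊆ X(Π_v)` `[L526–540]`, Question 1.9 `[qintroconj, L542–547]`,
  **Conj. 1.10** (SFT for `Δ[det]`) `[conjsftdet, L580–589]`, **Thm. 1.11** `[tnonadmissibilitynew,
  L609–633]` — row MS08-B (Defs. 6.1/10.1, §11, §12); Conj. 1.10 is an OPEN CONJECTURE and is not
  Literature (it would be an `@[conjecture]` under `Summits/`; tree data about it at `m = 3`:
  `DetThreeIdealDegreeTen.lean`, `HwvIdealDegreeCriterion.lean`).

§2 The orbit closure problem (e-print §3)
* setting `Y ⊇ X̄ ⊇ X`, `φ : W → V`, `w ↦ y^{m-n} w` `[L690–703]` — CITE `paddedPerPoly` (the case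
  `h = perm`; the tree pads with `X₀₀` and puts `X` bottom-right), `slSubgroup`, `linSubstRep`.
* **Def. 2.1** `[dpstablebasic, L705–709]` "`f = φ(h)` is partially stable … if `h ∈ P(W)` is stable
  with respect to the action of `SL_k(ℂ)`" — definitional over `IsPolystable h`; not restated.
* remark `[L716–718]` "`f` in Definition 2.1 belongs to the null cone of the `G`-action" — NEW PROVED
  `zero_mem_zariskiClosure_slOrbit_X_pow_mul_rename` (any padded form, one-parameter subgroup
  `λ_{a,b}`), `paddedPerPoly_not_isSLSemistable`, `paddedPerPoly_inNullCone`,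
  `paddedPerPoly_not_isPolystable` (`n < m`, `2 ≤ m`, infinite field).
* Problem 2.2 `[porbitclosure, L725–731]` — CITE `HasBorderDetRepr k n m` (the per/det instance).
* §2.1 class varieties for `NC` / `P^{#P}` `[L745–773]` — CITE `orbitClosure (detPoly (Fin m) ℂ)`,
  `orbitClosure (paddedPerPoly ℂ n m)`; "It is conjectured in part I that, if `m = 2^{O(polylog n)}`
  … `f ∉ Δ_V[g]`" `[L775–781]` — CITE the conjecture decls
  `Literature.StrongHypotheses.ValiantsHypothesis.MulmuleySohoniConjectureQP` (MS's window),
  `MulmuleySohoniConjecture` / `BorderDcPerSuperpolynomial` (`GCT.lean`, polynomial window) — OPEN,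
  never asserted; "This implies the arithmetic form of `NC ≠ P^{#P}`" — CITE
  `dcPerSuperpolynomial_of_mulmuleySohoni_holds` (`GCTProofs.lean`).
* **Thm. 2.3** (cf. Part I) `[tpart11, L788–801]`: `perm(X)` is `SL(X)`-stable, `det(Y)` is
  `G`-stable — CITE `BurgisserIkenmeyer2017_polystable_det_per_holds` (PROVED, Kempf–Ness);
  `f = φ(h)` partially stable — definitional; sentence after `[L803–808]` (both characterized by
  their stabilizers, hence excellent; `f` only almost excellent) — CITE the characterization
  theorems above; NEW `isStableExcellent_detPoly`, `isStableExcellent_perPoly_iff` (erratum-grade),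
  `not_isStableExcellent_paddedPerPoly`.
* stabilizers of `det(Y)` and `perm(X)` `[L810–822]` — CITE
  `Literature.NumberTheory.DiophantineGeometry.frobenius_detPreserver_unimodular_sandwich` (+ `_holds`,
  Frobenius/Marcus–Moyls) and `marcusMay1962_perPreserver_sandwich` (+ `_holds`,
  `PerStabilizerMarcusMay.lean`).
* Problem 2.4 (Kronecker problem) `[L827–838]` — CITE `kroneckerCoeff`, `symKroneckerCoeffRect`.
* §2.2, **Thm. 2.5** `[tpart12, L878–883]` (the `NP`-complete function `h` of Part I is stable) —
  NOT TYPED: the functions `E`, `H` are defined only in GCT I §7 (not held; row MS01-A).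

§3 Why should obstructions exist? (e-print §4)
* "there cannot be any obstruction for `m > n!`, or … `m > 2^{cn}`" `[L899–911]` — NEW PROVED with
  the explicit constant from Grenet (`dc(per_n) ≤ 2^n - 1`): `paddedPerPoly_mem_orbitClosure_detPoly_of_two_pow_le`,
  `not_hasMultiplicityObstruction_of_two_pow_le`, `not_hasOccurrenceObstruction_of_two_pow_le`,
  `not_hasStrongObstruction_of_two_pow_le`.
* étale slice / stabilizer containment at `l = k` `[L913–921]` ("cf. Part I") — NOT TYPED (Luna's
  étale slice theorem absent; GCT I not held; row MS01-A).
* **Prop. 3.1** `[pconjexobs, L929–937]` — NOT TYPED: its hypotheses are a BORDER DEPTH-complexity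
  lower bound for `perm` (no such notion in the tree; cf. `Literature/StrongHypotheses/
  ValiantsHypothesis.lean`, "Missing notion: borderComplexity") and `X(Π_g) = Δ_V[g]` (Conj. 1.10,
  `Π_g` = Def. 6.1, row MS08-B); the proof's core ("`f ∉ X(Π_g)` ⇒ some `S ∈ Π_g` does not vanish
  on `f` ⇒ strong obstruction") is the contrapositive of `exists_evalAtPoint_ne_zero` + Def. 1.3.
* **Conj. 3.2** `[L954–958]` (infinitely many STRONG obstructions for `(φ(perm), det)` if
  `m = 2^{log^c n}`) — a conjecture: not Literature; STATUS: by `HasStrongObstruction.hasOccurrenceObstruction`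
  a strong obstruction is an occurrence obstruction, and occurrence obstructions are REFUTED in the
  tree (NEW PROVED here: `not_hasStrongObstruction_of_bip`, no strong obstruction for `m ≥ (n+1)^{25}`)
  for `m ≥ n^{25}` (Bürgisser–Ikenmeyer–Panova 2019 Thm. 1.4: `Complexity.bip2019_no_occurrence_obstructions_holds`,
  barrier `Literature.Barriers.ValiantsHypothesis.GCTOccurrenceObstructions`, whose
  `.not_occurrenceObstructionRouteQP` covers the quasi-polynomial window); the multiplicity reading
  is the registered open hypothesis `Literature.StrongHypotheses.ValiantsHypothesis.GCTMultiplicityObstructionsQP`.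
* **Conj. 3.3** `[conjobpvsnp, L969–975]` (P vs NP pair) — NOT TYPED (functions of GCT I §7).

§4 Admissibility (e-print §5)
* **Def. 4.1** `[dadmissible, L1000–1012]` — CITE `IsAdmissible` (`H`-admissible; BLMW 2011
  Def. 6.1.3 "= [MS2]", `BLMW11StabilityInheritance.lean`); NEW `IsRelAdmissible` (`(H,W)`-admissible),
  `IsDualAdmissible` (the clause for general `H`: "`M^*` contains
  an `H`-invariant"; = "has an `H`-coinvariant" `[L1021–1024]`), `IsRelAdmissible.isAdmissible_of_trivial`;
  "if `H` is reductive, `M` contains an `H`-invariant iff `M^*` does" `[L1014–1018]` — NOT TYPED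
  (Weyl's complete reducibility for reductive `H`).
* `Δ̌[h]`, `ℂ[Δ̌[h]] = R[h]` `[L1026–1036]` — CITE `OrbitCoordRing`, `orbitCoordRingDeg`.
* **Prop. 4.2** `[peval, L1041–1057]`, first part — NEW PROVED: `evalAtPoint` (the evaluation map of
  the proof `[L1069–1073]`), `evalAtPoint_orbitCoordRep_of_eq_smul` ("`S^*` contains a `G_h`-module
  isomorphic to `(ℂh)^d`": evaluation transforms by the `d`-th power of the line character),
  `exists_evalAtPoint_ne_zero` ("Not all functions in `S` can vanish at `ĥ`" `[L1060–1067]`, under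
  `HasFullProjectiveOrbit G h`, which holds for `G = GL` and for `G = SL` over `ℂ`),
  `isDualAdmissible_stabilizer_of_subrepresentation` ("hence … `S^*` [is] `G_ĥ`-admissible"); the
  quantitative tree form is CITE `Literature.NumberTheory.DiophantineGeometry.finrank_highestWeightSpace_orbitCoordRep_le`
  (PROVED). Second part (induced bundle `G ×_H M`, global sections) `[L1051–1057]` — NOT TYPED
  (homogeneous bundles absent).

§5 Admissibility and stability (e-print §6)
* **Prop. 5.1** `[pstableorb, L1099–1113]` — dual form PROVED (`isDualAdmissible_stabilizer_of_subrepresentation`);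
  the invariant form ("must contain a nonzero `H`-invariant", `H` reductive, Weyl) is the "⇒" of
  the NAMED FACT `MS08_thm_1_8a`.
* **Prop. 5.2** `[pstableorbit2, L1119–1123]` ("Suppose `h` is stable. Then every `H`-admissible,
  irreducible `G`-module occurs in `R[h]`"; proof: Matsushima `[L1125–1127]`, algebraic Peter–Weyl
  `ℂ[G] = ⊕_S S ⊗ S^*`, `ℂ[G/H] = ⊕_S S ⊗ (S^*)^H` `[L1134–1150]`, closedness of `Gĥ` `[L1159–1168]`)
  — "⇐" of the NAMED FACT; projection `MS08_prop_5_2_of_thm_1_8a`. Proof of Thm. 1.8 (a)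
  `[L1169–1173]` = Props. 5.1 + 5.2.

## What is deliberately NOT here
No statement about VP vs VNP; no conjecture is asserted (Conj. 1.10, 3.2, 3.3 and the Part-I
conjecture are pointers only); no `instance`, no notation. One new named fact (`MS08_thm_1_8a`,
FACT-LIST R1); everything else is a definition with a real body or a proved theorem.
-/

noncomputable section

open MvPolynomial Representation

namespace Literature.Computability.AlgebraicComplexity

/-! ## §1 (journal) = e-print §2: semistable points and the null cone `[L233–240]` -/

section Semistable

variable {σ k : Type*} [Fintype σ] [DecidableEq σ] [Field k]

omit [Fintype σ] [DecidableEq σ] in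
/-- The coefficient vector of the zero polynomial is the zero vector. [folklore] -/
@[simp] private theorem coeffVec_zero : coeffVec (0 : MvPolynomial σ k) = 0 := by
  funext d; simp [coeffVec]

omit [Fintype σ] [DecidableEq σ] in
/-- `coeffVec (c • f) = c • coeffVec f`. [folklore] -/
@[simp] private theorem coeffVec_smul (c : k) (f : MvPolynomial σ k) :
    coeffVec (c • f) = c • coeffVec f := by
  funext d; simp [coeffVec]

/-- **Semistable form** (Mulmuley–Sohoni 2008, §1 `[tex:cs_0612134 main.tex L233–237]`: "Following
Mumford and Kempf, we say that `v` is *stable* if the orbit `G v̂ ⊆ V` is closed, and *semistable*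
if the closure of this orbit does not contain zero", with `G = SL(Y)`, `V = Sym^m(Y)`): the Zariski
closure, in coefficient space, of the `SL σ k`-orbit of `f` under linear substitution
(`slOrbit`, `Polystability.lean`) does not contain the zero vector. MS's "stable" is the tree's
`IsPolystable` (same file), which is cited, not restated.
[cite: MulmuleySohoniGCT2SIAM2008, §1 (definition of stable / semistable), arXiv cs/0612134 main.tex L233–237] -/
def IsSLSemistable (f : MvPolynomial σ k) : Prop :=
  coeffVec (0 : MvPolynomial σ k) ∉ zariskiClosure (coeffVec '' slOrbit σ k f)

/-- **Null cone** (Mulmuley–Sohoni 2008, §1 `[L237–240]`: "We say `v` belongs to the *null cone* if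
all homogeneous `G`-invariants of positive degree vanish at `v̂`"), for `G = SL σ k` acting on
`V = Sym^m(k^σ)`: every polynomial function `F` on `Sym^m` (`MvPolynomial (DegIdx σ m) k`, with the
action `coordRep σ k m`, `OrbitCoordinateRing.lean`) that is homogeneous of some positive degree
and invariant under `slSubgroup σ k` vanishes at the coefficient vector `formCoeff m f` of `f`.
[cite: MulmuleySohoniGCT2SIAM2008, §1 (definition of the null cone), arXiv cs/0612134 main.tex L237–240] -/
def InNullCone (f : MvPolynomial σ k) (m : ℕ) : Prop :=
  ∀ (F : MvPolynomial (DegIdx σ m) k) (e : ℕ), 0 < e → F.IsHomogeneous e →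
    (∀ γ ∈ slSubgroup σ k, coordRep σ k m γ F = F) → aeval (formCoeff m f) F = 0

/-- `formCoeff m 0 = 0`. [folklore] -/
@[simp] private theorem formCoeff_zero (m : ℕ) : formCoeff m (0 : MvPolynomial σ k) = 0 := by
  funext d; simp [formCoeff]

/-- Evaluating a polynomial in the degree-`m` coordinates at `formCoeff m h` is evaluating its
renaming to all-monomial coordinates at `coeffVec h`. [folklore] -/
private theorem aeval_coeffVec_rename_formCoeff (m : ℕ) (h : MvPolynomial σ k)
    (F : MvPolynomial (DegIdx σ m) k) :
    aeval (coeffVec h) (rename (fun d : DegIdx σ m => (d.1 : σ →₀ ℕ)) F) =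
      aeval (formCoeff m h) F := by
  rw [aeval_rename]
  rfl

/-- A homogeneous polynomial function of positive degree vanishes at the origin. [folklore] -/
private theorem aeval_zero_of_isHomogeneous_pos {τ : Type*} {F : MvPolynomial τ k} {e : ℕ} (he : 0 < e)
    (hF : F.IsHomogeneous e) : aeval (0 : τ → k) F = 0 := by
  rw [aeval_zero, constantCoeff_eq, hF.coeff_eq_zero, map_zero]
  simp only [map_zero]
  omega

/-- **Elementary half of the Hilbert–Mumford description of the null cone**: if the zero vector lies
in the Zariski closure of the `SL`-orbit of `f`, then every homogeneous `SL`-invariant of positive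
degree vanishes at `f` (an invariant `F` is constant `= F(f̂)` on the orbit, hence on its closure,
and `F(0) = 0`). Mulmuley–Sohoni 2008 §1 (the definitions); Mumford–Fogarty–Kirwan, GIT, Ch. 1 §5.
[cite: MulmuleySohoniGCT2SIAM2008, §1 (stable / semistable / null cone), arXiv cs/0612134 main.tex L233–240] -/
theorem inNullCone_of_zero_mem_zariskiClosure_slOrbit {f : MvPolynomial σ k} (m : ℕ)
    (h0 : coeffVec (0 : MvPolynomial σ k) ∈ zariskiClosure (coeffVec '' slOrbit σ k f)) :
    InNullCone f m := by
  intro F e he hF hinv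
  -- the test polynomial `F - F(f̂)` in all-monomial coordinates vanishes on the orbit
  set c : k := aeval (formCoeff m f) F with hc
  have hvan := (mem_zariskiClosure_iff.mp h0)
    (rename (fun d : DegIdx σ m => (d.1 : σ →₀ ℕ)) F - C c) (by
      rintro _ ⟨h, ⟨g, rfl⟩, rfl⟩
      rw [map_sub, aeval_C, aeval_coeffVec_rename_formCoeff, Algebra.algebraMap_self,
        RingHom.id_apply, sub_eq_zero, hc]
      -- invariance: `F(g · f) = (γ · F)(f)` with `γ = (toGL g)`, and `γ · F = F`
      have hγ : (Matrix.SpecialLinearGroup.toGL g : GL σ k) ∈ slSubgroup σ k := ⟨g, rfl⟩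
      have h1 := aeval_formCoeff_coordSubst m (Matrix.SpecialLinearGroup.toGL g)⁻¹ f F
      rw [inv_inv, ← coordRep_apply, hinv _ (inv_mem hγ)] at h1
      rw [h1, linSubstRep_apply]
      rfl)
  rw [map_sub, aeval_C, aeval_coeffVec_rename_formCoeff] at hvan
  have : aeval (formCoeff m (0 : MvPolynomial σ k)) F = 0 := by
    rw [formCoeff_zero]; exact aeval_zero_of_isHomogeneous_pos he hF
  rw [this, zero_sub, neg_eq_zero, Algebra.algebraMap_self, RingHom.id_apply] at hvan
  exact hvan

/-- A point in the null cone (in the closure sense) is not semistable — restatement of the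
definition. [cite: MulmuleySohoniGCT2SIAM2008, §1 (definition of semistable), arXiv cs/0612134 main.tex L233–237] -/
theorem not_isSLSemistable_iff {f : MvPolynomial σ k} :
    ¬ IsSLSemistable f ↔
      coeffVec (0 : MvPolynomial σ k) ∈ zariskiClosure (coeffVec '' slOrbit σ k f) := by
  rw [IsSLSemistable, not_not]

/-- **Stable ⇒ semistable** for a nonzero form (Mulmuley–Sohoni 2008 §1: a closed orbit `SL · f̂`,
`f̂ ≠ 0`, does not pass through `0`): if the `SL`-orbit of `f ≠ 0` is Zariski closed in
coefficient space (`IsPolystable f`) then its closure does not contain `0`.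
[cite: MulmuleySohoniGCT2SIAM2008, §1 (definitions of stable / semistable), arXiv cs/0612134 main.tex L233–237] -/
theorem IsPolystable.isSLSemistable {f : MvPolynomial σ k} (hst : IsPolystable f) (hf : f ≠ 0) :
    IsSLSemistable f := by
  intro h0
  obtain ⟨h, ⟨g, rfl⟩, hh⟩ := hst h0
  have hzero : linSubst σ k (g : Matrix σ σ k) f = 0 :=
    coeffVec_injective (by rw [hh, coeffVec_zero])
  apply hf
  have : linSubst σ k ((g⁻¹ : Matrix.SpecialLinearGroup σ k) : Matrix σ σ k)
      (linSubst σ k (g : Matrix σ σ k) f) = f := by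
    rw [← AlgHom.comp_apply, ← linSubst_mul, ← Matrix.SpecialLinearGroup.coe_mul, inv_mul_cancel,
      Matrix.SpecialLinearGroup.coe_one, linSubst_one, AlgHom.id_apply]
  rw [← this, hzero, map_zero]

end Semistable

/-! ## §2 (journal), remark after Def. 2.1 `[L716–718]`: padded forms lie in the null cone -/

section PaddedNullCone

variable {σ k : Type*} [Fintype σ] [DecidableEq σ] [Field k]

/-- A diagonal substitution fixes a polynomial in variables on which the diagonal is `1`.
[folklore] -/
private theorem linSubst_diagonal_rename_of_eq_one {τ : Type*} (ι : τ → σ) (c : σ → k)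
    (hc : ∀ j, c (ι j) = 1) (g : MvPolynomial τ k) :
    linSubst σ k (Matrix.diagonal c) (rename ι g) = rename ι g := by
  have : (linSubst σ k (Matrix.diagonal c)).comp (rename ι) = rename ι := by
    apply MvPolynomial.algHom_ext
    intro j
    rw [AlgHom.comp_apply, rename_X, Grenet.linSubst_diagonal_X, hc, one_smul]
  exact congrArg (fun φ => φ g) this

/-- The one-parameter diagonal `λ_{a,b}(t) = diag(…, t (at a), …, t⁻¹ (at b), …, 1, …)`. [folklore] -/
def twoPointDiag (a b : σ) (t : k) : σ → k :=
  Function.update (Function.update (fun _ => (1 : k)) b t⁻¹) a t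

omit [Fintype σ] in
/-- Values of `twoPointDiag`. [folklore] -/
private theorem twoPointDiag_apply (a b : σ) (t : k) (i : σ) :
    twoPointDiag a b t i = if i = a then t else if i = b then t⁻¹ else 1 := by
  unfold twoPointDiag
  simp only [Function.update_apply]

/-- `det (diag λ_{a,b}(t)) = 1` for `a ≠ b`, `t ≠ 0`. [folklore] -/
private theorem det_diagonal_twoPointDiag {a b : σ} (hab : a ≠ b) {t : k} (ht : t ≠ 0) :
    (Matrix.diagonal (twoPointDiag a b t)).det = 1 := by
  rw [Matrix.det_diagonal, twoPointDiag, Finset.prod_update_of_mem (Finset.mem_univ a),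
    Finset.prod_update_of_mem (by simp [Finset.mem_sdiff, Ne.symm hab])]
  simp [mul_inv_cancel₀ ht]

/-- The one-parameter subgroup `λ_{a,b}` of `SL σ k` rescales the padded form
`X a ^ e * g` (with `g` free of `X a`, `X b`) by `t ^ e` — the one-parameter-subgroup computation
behind MS's remark after Def. 2.1 ("follows easily from the Hilbert-Mumford criterion").
[cite: MulmuleySohoniGCT2SIAM2008, §2 remark after Def. 2.1, arXiv cs/0612134 main.tex L716–718] -/
theorem linSubst_twoPointDiag_X_pow_mul_rename {τ : Type*} (ι : τ → σ) {a b : σ}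
    (ha : ∀ j, ι j ≠ a) (hb : ∀ j, ι j ≠ b) (e : ℕ) (g : MvPolynomial τ k) (t : k) :
    linSubst σ k (Matrix.diagonal (twoPointDiag a b t)) (X a ^ e * rename ι g) =
      t ^ e • (X a ^ e * rename ι g) := by
  rw [map_mul, map_pow, Grenet.linSubst_diagonal_X,
    linSubst_diagonal_rename_of_eq_one ι _ (fun j => by
      rw [twoPointDiag_apply, if_neg (ha j), if_neg (hb j)]) g,
    twoPointDiag_apply, if_pos rfl, smul_pow, smul_mul_assoc]

/-- **A padded form lies in the null cone** (Mulmuley–Sohoni 2008, §2, after Def. 2.1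
`[tex:cs_0612134 main.tex L716–718]`: "Note that `f` in Definition 2.1 [`f = φ(h) = y^{m-n} h`] belongs
to the null cone of the `G`-action–this follows easily from the Hilbert-Mumford criterion"), in
the closure form and for any padded form `X a ^ e * g`, `e > 0`, where `g` is a polynomial in
variables other than `X a` and some further spare variable `X b` (over an infinite field):
`0` lies in the Zariski closure of the `SL`-orbit, via the one-parameter subgroup `λ_{a,b}(t)`,
which rescales the form by `t ^ e`, and a one-variable polynomial identity in `t`.
[cite: MulmuleySohoniGCT2SIAM2008, §2 remark after Def. 2.1, arXiv cs/0612134 main.tex L716–718] -/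
theorem zero_mem_zariskiClosure_slOrbit_X_pow_mul_rename [Infinite k] {τ : Type*} (ι : τ → σ)
    {a b : σ} (hab : a ≠ b) (ha : ∀ j, ι j ≠ a) (hb : ∀ j, ι j ≠ b) {e : ℕ} (he : 0 < e)
    (g : MvPolynomial τ k) :
    coeffVec (0 : MvPolynomial σ k) ∈
      zariskiClosure (coeffVec '' slOrbit σ k (X a ^ e * rename ι g)) := by
  set f : MvPolynomial σ k := X a ^ e * rename ι g with hf
  rw [mem_zariskiClosure_iff]
  intro p hp
  -- the one-variable polynomial `t ↦ p(t^e • coeffVec f)`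
  set R : Polynomial k :=
    aeval (fun d : σ →₀ ℕ => Polynomial.X ^ e * Polynomial.C (coeffVec f d)) p with hR
  have hReval : ∀ t : k, Polynomial.aeval t R = aeval (t ^ e • coeffVec f) p := by
    intro t
    rw [hR, ← AlgHom.comp_apply]
    congr 1
    apply MvPolynomial.algHom_ext
    intro d
    simp [Pi.smul_apply, smul_eq_mul]
    ring
  -- it vanishes at every `t ≠ 0`, since `t^e • f` is in the `SL`-orbit
  have hroots : ∀ t : k, t ≠ 0 → R.IsRoot t := by
    intro t ht
    rw [Polynomial.IsRoot, ← Polynomial.coe_aeval_eq_eval, hReval, ← coeffVec_smul]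
    refine hp _ ⟨t ^ e • f, ⟨⟨Matrix.diagonal (twoPointDiag a b t),
      det_diagonal_twoPointDiag hab ht⟩, ?_⟩, rfl⟩
    exact (linSubst_twoPointDiag_X_pow_mul_rename ι ha hb e g t).symm
  have hR0 : R = 0 := by
    apply Polynomial.eq_zero_of_infinite_isRoot
    exact ((Set.finite_singleton (0 : k)).infinite_compl).mono fun t ht => hroots t ht
  have := hReval 0
  rw [hR0, map_zero, zero_pow (Nat.pos_iff_ne_zero.mp he), zero_smul] at this
  rw [coeffVec_zero]
  exact this.symm

/-- Hence such a padded form is **not semistable** (over an infinite field).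
[cite: MulmuleySohoniGCT2SIAM2008, §2 remark after Def. 2.1, arXiv cs/0612134 main.tex L716–718] -/
theorem not_isSLSemistable_X_pow_mul_rename [Infinite k] {τ : Type*} (ι : τ → σ)
    {a b : σ} (hab : a ≠ b) (ha : ∀ j, ι j ≠ a) (hb : ∀ j, ι j ≠ b) {e : ℕ} (he : 0 < e)
    (g : MvPolynomial τ k) : ¬ IsSLSemistable (X a ^ e * rename ι g : MvPolynomial σ k) :=
  not_isSLSemistable_iff.mpr (zero_mem_zariskiClosure_slOrbit_X_pow_mul_rename ι hab ha hb he g)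

/-- **MS's `f = φ(perm)` is in the null cone**: for `n < m` and `2 ≤ m` the padded permanent
`paddedPerPoly k n m = X₀₀^{m-n} · per_n` (bottom-right block, `OrbitClosure.lean`) is not
semistable under `SL_{m²}` — the spare variable is `X₀₁`, which lies outside the block together
with `X₀₀` (over an infinite field). Mulmuley–Sohoni 2008, §2, remark after Def. 2.1.
[cite: MulmuleySohoniGCT2SIAM2008, §2 remark after Def. 2.1, arXiv cs/0612134 main.tex L716–718] -/
theorem paddedPerPoly_not_isSLSemistable [Infinite k] {n m : ℕ} [NeZero m] (hnm : n < m)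
    (hm : 2 ≤ m) : ¬ IsSLSemistable (paddedPerPoly k n m) := by
  have h0 : (0 : ℕ) < m := by omega
  have h1 : (1 : ℕ) < m := by omega
  unfold paddedPerPoly
  refine not_isSLSemistable_X_pow_mul_rename _ (a := ((0 : Fin m), (0 : Fin m)))
    (b := (⟨0, h0⟩, ⟨1, h1⟩)) ?_ ?_ ?_ (by omega) _
  · simp [Prod.ext_iff, Fin.ext_iff]
  · rintro ⟨i, j⟩ h
    have := i.2
    simp only [Prod.mk.injEq] at h
    have hi : ((i : Fin m) : ℕ) = 0 := by rw [h.1]; rfl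
    omega
  · rintro ⟨i, j⟩ h
    have := i.2
    simp only [Prod.mk.injEq] at h
    have hi : ((i : Fin m) : ℕ) = 0 := by rw [h.1]
    omega

/-- The same in MS's words: the padded permanent **belongs to the null cone** — every homogeneous
`SL_{m²}`-invariant of positive degree on `Sym^m` vanishes at it (`n < m`, `2 ≤ m`, infinite
field). [cite: MulmuleySohoniGCT2SIAM2008, §2 remark after Def. 2.1, arXiv cs/0612134 main.tex L716–718] -/
theorem paddedPerPoly_inNullCone [Infinite k] {n m : ℕ} [NeZero m] (hnm : n < m) (hm : 2 ≤ m) :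
    InNullCone (paddedPerPoly k n m) m :=
  inNullCone_of_zero_mem_zariskiClosure_slOrbit m
    (not_isSLSemistable_iff.mp (paddedPerPoly_not_isSLSemistable hnm hm))

/-- The padded permanent is nonzero (any field). [folklore] -/
private theorem paddedPerPoly_ne_zero' (n m : ℕ) [NeZero m] : paddedPerPoly k n m ≠ 0 := by
  have hinj : Function.Injective
      (fun ij : BlockIdx n m × BlockIdx n m => ((ij.1 : Fin m), (ij.2 : Fin m))) := by
    intro a b h
    simp only [Prod.mk.injEq] at h
    exact Prod.ext (Subtype.ext h.1) (Subtype.ext h.2)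
  unfold paddedPerPoly
  refine mul_ne_zero (pow_ne_zero _ (X_ne_zero _)) fun h => perPoly_ne_zero (BlockIdx n m) k ?_
  exact rename_injective _ hinj (by rw [h, map_zero])

/-- **MS's `f = φ(perm)` is not stable**: in contrast with `per_n` and `det_m` themselves
(`BurgisserIkenmeyer2017_polystable_det_per_holds`), the padded permanent `X₀₀^{m-n} per_n`,
`n < m`, `2 ≤ m`, is not polystable — its `SL_{m²}`-orbit is not closed (it is "partially stable
with defect one", Mulmuley–Sohoni 2008 §2 after Def. 2.1 / Thm. 2.3). Infinite field.
[cite: MulmuleySohoniGCT2SIAM2008, §2 remark after Def. 2.1 and Thm. 2.3, arXiv cs/0612134 main.tex L709–718] -/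
theorem paddedPerPoly_not_isPolystable [Infinite k] {n m : ℕ} [NeZero m] (hnm : n < m)
    (hm : 2 ≤ m) : ¬ IsPolystable (paddedPerPoly k n m) :=
  fun h => paddedPerPoly_not_isSLSemistable hnm hm (h.isSLSemistable (paddedPerPoly_ne_zero' n m))

end PaddedNullCone

/-! ## §1: excellent points, stable branch `[L263–268]`; Thm. 2.3 `[L788–808]` -/

section Excellent

variable {σ k : Type*} [Fintype σ] [DecidableEq σ] [Field k]

/-- **Excellent point, stable branch** (Mulmuley–Sohoni 2008, §1 `[tex:cs_0612134 main.tex L263–268]`: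
"We say that `v` is *excellent* if (1) it is stable or partially stable with defect zero, and
(2) it is characterized by its stabilizer", `G = SL(Y)` acting on `V = Sym^m(Y)`): the conjunction
"`f` is stable (`IsPolystable f`: the `SL σ k`-orbit is closed) and `f` is characterized by its
stabilizer in `SL σ k` (`IsCharacterizedByStabilizerIn (slSubgroup σ k) f m`)". For a STABLE point
this is exactly MS's "excellent" (a stable point is partially stable by definition, loc. cit.
`[L241]`). -- TODO(general form): the second branch "partially stable with defect zero, i.e.
`(L,P)`-stable for Kempf's canonical destabilizing flag `P = P[S,v]`" `[L244–258]` needs Kempf's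
theory of optimal one-parameter subgroups (absent from Mathlib and the tree) and is NOT typed; MS's
`f = φ(h)` has defect one and is only "almost excellent" `[L806–808]`, see
`not_isStableExcellent_paddedPerPoly`.
[cite: MulmuleySohoniGCT2SIAM2008, §1 (definition of excellent), arXiv cs/0612134 main.tex L263–268] -/
def IsStableExcellent (f : MvPolynomial σ k) (m : ℕ) : Prop :=
  IsPolystable f ∧ IsCharacterizedByStabilizerIn (slSubgroup σ k) f m

/-- **`det_m` is excellent** (Mulmuley–Sohoni 2008, Thm. 2.3 and the sentence after it
`[L799–806]`: "`g = det(Y) ∈ P(V)` is stable with respect to the action of `G` on `P(V)` …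
Moreover, both `perm(X)` and `det(Y)` are characterized by their stabilizers. Hence, both `h` and
`g` are excellent"; also §1 `[L272]`: "the determinant function above is excellent"), for every
`m`, in the literal `G = SL(Y)` reading: assembled from the tree's theorems
`BurgisserIkenmeyer2017_polystable_det_per_holds` (Kempf–Ness) and
`isCharacterizedByStabilizerIn_slSubgroup_detPoly`.
[cite: MulmuleySohoniGCT2SIAM2008, Thm. 2.3 (arXiv cs/0612134 Thm. 3.3, main.tex L788–806)] -/
theorem isStableExcellent_detPoly (m : ℕ) : IsStableExcellent (detPoly (Fin m) ℂ) m :=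
  ⟨(BurgisserIkenmeyer2017_polystable_det_per_holds m).1,
    isCharacterizedByStabilizerIn_slSubgroup_detPoly m⟩

/-- **`per_n` is excellent iff `n ≢ 1 (mod 4)`** (`n ≥ 2`), in the literal `G = SL(X)` reading of
Mulmuley–Sohoni 2008, Thm. 2.3 `[L788–806]` ("The point `h = perm(X)` is stable with respect to
the action of `SL(X)` … both `perm(X)` and `det(Y)` are characterized by their stabilizers. Hence,
both `h` and `g` are excellent"). ERRATUM-GRADE STATUS of the printed sentence: stability holds
for all `n` (`BurgisserIkenmeyer2017_polystable_det_per_holds`), but the `SL_{n²}`-stabilizer of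
`per_n` also fixes `det_n` when `n ≡ 1 (mod 4)` (`not_isCharacterizedByStabilizerIn_slSubgroup_perPoly`,
`CharacterizedByStabilizerSL.lean`), so the printed claim holds exactly for `n ≢ 1 (mod 4)`; in the
`Ĝ = GL` reading of the GCT Introduction it holds for all `n`
(`isPolystable_and_isCharacterizedByStabilizer_perPoly`).
[cite: MulmuleySohoniGCT2SIAM2008, Thm. 2.3 (arXiv cs/0612134 Thm. 3.3, main.tex L788–806)] -/
theorem isStableExcellent_perPoly_iff {n : ℕ} (h2 : 2 ≤ n) :
    IsStableExcellent (perPoly (Fin n) ℂ) n ↔ n % 4 ≠ 1 :=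
  ⟨fun h => (isCharacterizedByStabilizerIn_slSubgroup_perPoly_iff h2).mp h.2,
    fun h => ⟨(BurgisserIkenmeyer2017_polystable_det_per_holds n).2,
      isCharacterizedByStabilizerIn_slSubgroup_perPoly h⟩⟩

/-- `per_n` is excellent (`SL` reading) whenever `n ≢ 1 (mod 4)` (all such `n`, including
`n = 0`). [cite: MulmuleySohoniGCT2SIAM2008, Thm. 2.3 (arXiv cs/0612134 Thm. 3.3, main.tex L788–806)] -/
theorem isStableExcellent_perPoly {n : ℕ} (h : n % 4 ≠ 1) : IsStableExcellent (perPoly (Fin n) ℂ) n :=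
  ⟨(BurgisserIkenmeyer2017_polystable_det_per_holds n).2,
    isCharacterizedByStabilizerIn_slSubgroup_perPoly h⟩

/-- The smallest counterexample to the printed sentence in the `SL` reading: `per_5` is stable but
NOT characterized by its `SL_25`-stabilizer, hence not excellent for `G = SL(X)`.
[cite: MulmuleySohoniGCT2SIAM2008, Thm. 2.3 (arXiv cs/0612134 Thm. 3.3, main.tex L788–806)] -/
theorem not_isStableExcellent_perPoly_five : ¬ IsStableExcellent (perPoly (Fin 5) ℂ) 5 :=
  fun h => (isStableExcellent_perPoly_iff (by norm_num)).mp h (by norm_num)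

/-- The `Ĝ = GL(X)` reading (GCT Introduction, Lecture 13; GCT II Thm. 2.3 "as well as
`Ĝ = GL(Y)`"): `per_n` is stable and characterized by its stabilizer in `GL_{n²}`, for every `n`
(`perPoly_isCharacterizedByStabilizer_holds`).
[cite: MulmuleySohoniGCT2SIAM2008, Thm. 2.3 (arXiv cs/0612134 Thm. 3.3, main.tex L788–806)] -/
theorem isPolystable_and_isCharacterizedByStabilizer_perPoly (n : ℕ) :
    IsPolystable (perPoly (Fin n) ℂ) ∧ IsCharacterizedByStabilizer (perPoly (Fin n) ℂ) n :=
  ⟨(BurgisserIkenmeyer2017_polystable_det_per_holds n).2, perPoly_isCharacterizedByStabilizer_holds n⟩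

/-- **MS's `f = φ(h)` is not excellent in the stable branch** ("in contrast, `f = φ(h)` is only
almost excellent–because its defect of partial stability is one" `[L806–808]`): the padded
permanent is not even stable (`paddedPerPoly_not_isPolystable`), although it IS characterized by
its stabilizer (`isCharacterizedByStabilizerIn_slSubgroup_paddedPerPoly`, `m ≥ 3`). `n < m`,
`2 ≤ m`, infinite field. [cite: MulmuleySohoniGCT2SIAM2008, Thm. 2.3 and after (main.tex L806–808)] -/
theorem not_isStableExcellent_paddedPerPoly [Infinite k] {n m : ℕ} [NeZero m] (hnm : n < m)
    (hm : 2 ≤ m) : ¬ IsStableExcellent (paddedPerPoly k n m) m :=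
  fun h => paddedPerPoly_not_isPolystable hnm hm h.1

end Excellent

/-! ## §3 "Why should obstructions exist?" `[L893–921]`: none for `m ≥ 2^n - 1` -/

section WhyObstructions

variable {k : Type*} [Field k]

/-- **No obstruction for large `m`** (Mulmuley–Sohoni 2008, §3 `[tex:cs_0612134 main.tex L899–911]`:
"an obstruction for the pair `(f,g)` cannot exist if `l` is sufficiently larger than `k`. For
example, let `(f,g) = (φ(h),g)`, where `h = perm(X)` and `g = det(Y)` … Then there cannot be any
obstruction for `m > n!`, or for that matter, `m > 2^{cn}` for a large enough constant `c`. This is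
because `perm(X)` has a formula of size `2^{cn}` … and hence `f ∈ Δ_V[g]`, for `m > 2^{cn}`"), with
the explicit constant supplied by Grenet's `dc(per_n) ≤ 2^n - 1` (`determinantalComplexity_perPoly_le_holds`):
for `n ≥ 1` and `m ≥ 2^n - 1` the padded permanent `X₀₀^{m-n} per_n` lies in the orbit closure of
`det_m` (over any infinite field; via `paddedPerPoly_mem_orbitClosure_detPoly_of_hasDetRepr_holds`,
GCT I Prop. 4.4). This covers MS's "`m > n!`" for `n ≥ 4` and "`m > 2^{cn}`" with `c = 1`.
[cite: MulmuleySohoniGCT2SIAM2008, §3 (arXiv cs/0612134 §4, main.tex L899–911)] -/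
theorem paddedPerPoly_mem_orbitClosure_detPoly_of_two_pow_le [Infinite k] {n m : ℕ} [NeZero m]
    (hn : 1 ≤ n) (hm : 2 ^ n ≤ m + 1) :
    paddedPerPoly k n m ∈ orbitClosure (detPoly (Fin m) k) := by
  have hdc : determinantalComplexity (perPoly (Fin n) k) ≤ 2 ^ n - 1 :=
    determinantalComplexity_perPoly_le_holds k n hn
  have h2 : n < 2 ^ n := Nat.lt_two_pow_self
  have hnm : n ≤ m := by omega
  have hrepr : HasDetRepr (perPoly (Fin n) k) m :=
    HasDetRepr.mono_holds (hasDetRepr_determinantalComplexity_holds _) (by omega)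
  exact paddedPerPoly_mem_orbitClosure_detPoly_of_hasDetRepr_holds hrepr hnm

/-- Hence **no multiplicity obstruction** (no irreducible with larger multiplicity in
`k[Δ(X₀₀^{m-n} per_n)]_d` than in `k[Δ(det_m)]_d`, `HasMultiplicityObstruction`) exists in any
degree `d` once `m ≥ 2^n - 1`, `n ≥ 1` (obstruction principle
`not_hasMultiplicityObstruction_of_mem_orbitClosure`). Infinite field.
[cite: MulmuleySohoniGCT2SIAM2008, §3 (arXiv cs/0612134 §4, main.tex L899–911)] -/
theorem not_hasMultiplicityObstruction_of_two_pow_le [Infinite k] {n m : ℕ} [NeZero m]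
    (hn : 1 ≤ n) (hm : 2 ^ n ≤ m + 1) (d : ℕ) :
    ¬ HasMultiplicityObstruction (detPoly (Fin m) k) (paddedPerPoly k n m) m d :=
  not_hasMultiplicityObstruction_of_mem_orbitClosure
    (paddedPerPoly_mem_orbitClosure_detPoly_of_two_pow_le hn hm) d

/-- … and **no (occurrence) obstruction in the sense of Def. 1.2** (`HasOccurrenceObstruction`)
in any degree, over `ℂ`, for `m ≥ 2^n - 1`, `n ≥ 1` (occurrence obstructions are multiplicity
obstructions over `ℂ`, `hasMultiplicityObstruction_of_hasOccurrenceObstruction_complex_holds`).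
[cite: MulmuleySohoniGCT2SIAM2008, §3 (arXiv cs/0612134 §4, main.tex L899–911)] -/
theorem not_hasOccurrenceObstruction_of_two_pow_le {n m : ℕ} [NeZero m]
    (hn : 1 ≤ n) (hm : 2 ^ n ≤ m + 1) (d : ℕ) :
    ¬ HasOccurrenceObstruction (detPoly (Fin m) ℂ) (paddedPerPoly ℂ n m) m d := by
  intro h
  have h2 : n < 2 ^ n := Nat.lt_two_pow_self
  exact not_hasMultiplicityObstruction_of_two_pow_le hn hm d
    (hasMultiplicityObstruction_of_hasOccurrenceObstruction_complex_holds
      (by simpa using detPoly_isHomogeneous (n := Fin m) (k := ℂ))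
      (paddedPerPoly_isHomogeneous (by omega)) h)

end WhyObstructions

/-! ## §4 Admissibility: Def. 4.1 `[L1000–1018]` -/

section Admissible

variable {k : Type*} [Field k] {Γ : Type*} [Group Γ] {M N : Type*} [AddCommGroup M] [Module k M]
  [AddCommGroup N] [Module k N]

/- **`H`-admissible module** (Mulmuley–Sohoni 2008, Def. 4.1 `[L1005–1008]`: "We say that `M` is
`H`-admissible if it is `(H,1_H)`-admissible … i.e., if it contains a (nonzero) `H`-invariant";
§1 `[L474–475]`) is ALREADY in the tree as `IsAdmissible ρ H := subgroupInvariants ρ H ≠ ⊥`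
(`BLMW11StabilityInheritance.lean`, BLMW 2011 Def. 6.1.3 "= [MS2]", with `isAdmissible_iff_exists`)
and is used below, not restated. -/

/-- **Admissibility for a general (not necessarily reductive) `H`** (Def. 4.1, last clause
`[L1010–1012]`: "we say that `M` is `H`-admissible if `M^*` contains an `H`-invariant"; §4
`[L1021–1024]`: "`S` has an `H`-coinvariant if … the dual module `S^*` has an `H`-invariant"): the
dual `M^*` has a nonzero `H`-invariant, i.e. a nonzero linear functional `φ` with `φ ∘ ρ(h) = φ`
for `h ∈ H`. For reductive `H` the two notions agree (Weyl's complete reducibility, `[L1014–1018]`;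
not formalised: no reductive groups in Mathlib).
[cite: MulmuleySohoniGCT2SIAM2008, Def. 4.1 (arXiv cs/0612134 Def. 5.1, main.tex L1010–1024)] -/
def IsDualAdmissible (H : Subgroup Γ) (ρ : Representation k Γ M) : Prop :=
  ∃ φ : M →ₗ[k] k, φ ≠ 0 ∧ ∀ h ∈ H, φ ∘ₗ ρ h = φ

/-- **`(H,W)`-admissible module** (Def. 4.1, first clause `[L1000–1004]`: "Given a reductive
subgroup `H ⊆ G` and an `H`-module `W`, we say that a `G`-module `M` is `(H,W)`-admissible, if some
irreducible `H`-submodule of `M` occurs in `W`"): some irreducible subrepresentation `S` of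
`ρ|_H` admits an injective `H`-equivariant linear map into `W` (here `W` carries the restriction
of a `Γ`-representation `τ`, which covers MS's uses: `W = 1_H` and `W` a `G_v̂`-module obtained by
restriction). [cite: MulmuleySohoniGCT2SIAM2008, Def. 4.1 (arXiv cs/0612134 Def. 5.1, main.tex L1000–1004)] -/
def IsRelAdmissible (H : Subgroup Γ) (ρ : Representation k Γ M) (τ : Representation k Γ N) :
    Prop :=
  ∃ S : Subrepresentation (ρ.comp H.subtype), S.toRepresentation.IsIrreducible ∧
    ∃ ι : IntertwiningMap S.toRepresentation (τ.comp H.subtype), Function.Injective ι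

/-- MS's "i.e." in Def. 4.1 `[L1005–1008]`, the direction that uses irreducibility: a module
that is `(H, 1_H)`-admissible (some irreducible `H`-submodule maps injectively and equivariantly to
the trivial module `1_H = k`) contains a nonzero `H`-invariant. [cite: MulmuleySohoniGCT2SIAM2008, Def. 4.1 (arXiv cs/0612134 Def. 5.1, main.tex L1005–1008)] -/
theorem IsRelAdmissible.isAdmissible_of_trivial {H : Subgroup Γ} {ρ : Representation k Γ M}
    (h : IsRelAdmissible H ρ (Representation.trivial k Γ k)) : IsAdmissible ρ H := by
  obtain ⟨S, hS, ι, hι⟩ := h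
  have hnt : (⊥ : Subrepresentation S.toRepresentation) ≠ ⊤ := bot_ne_top
  obtain ⟨v, hv⟩ : ∃ v : S.toSubmodule, v ≠ 0 := by
    by_contra hall
    push Not at hall
    apply hnt
    apply Subrepresentation.toSubmodule_injective
    change (⊥ : Submodule k S.toSubmodule) = ⊤
    rw [eq_comm, Submodule.eq_bot_iff]
    exact fun x _ => hall x
  refine isAdmissible_iff_exists.mpr ⟨(v : M), fun h0 => hv (Subtype.ext h0), fun g hg => ?_⟩
  have h1 := IntertwiningMap.isIntertwining _ _ ι ⟨g, hg⟩ v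
  rw [MonoidHom.comp_apply, Representation.trivial_apply] at h1
  have h2 : S.toRepresentation ⟨g, hg⟩ v = v := hι h1
  exact congrArg Subtype.val h2

end Admissible

/-! ## §4 Prop. 4.2 `[L1041–1077]`: evaluation at the point; Def. 1.3 and "strong ⇒ obstruction" -/

section Evaluation

variable {σ k : Type*} [Fintype σ] [DecidableEq σ] [Field k]

/-- **Evaluation at the point `f̂`**: the `k`-algebra map `k[Δ[f]] = k[Sym^m] ⧸ I(GL·f) → k`,
`[F] ↦ F(f̂)` (well defined: `I(GL·f)` vanishes at `f = 1 · f`). This is the map `φ` of the proof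
of Prop. 4.2 `[L1069–1073]` ("the evaluation map … that maps every function in `S` to its
restriction on the line `ℂh`"). [cite: MulmuleySohoniGCT2SIAM2008, Prop. 4.2 proof (arXiv cs/0612134 Prop. 5.2, main.tex L1069–1073)] -/
def evalAtPoint (f : MvPolynomial σ k) (m : ℕ) : OrbitCoordRing f m →ₐ[k] k :=
  Ideal.Quotient.liftₐ (orbitVanishingIdeal f m) (aeval (formCoeff m f)) (fun F hF => by
    have := mem_orbitVanishingIdeal_iff.mp hF 1
    rwa [map_one, Module.End.one_apply] at this)

/-- `evalAtPoint` on the class of a polynomial function: `[F] ↦ F(f̂)` (the evaluation map of the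
proof of Prop. 4.2). [cite: MulmuleySohoniGCT2SIAM2008, Prop. 4.2 proof (arXiv cs/0612134 Prop. 5.2, main.tex L1069–1073)] -/
@[simp] theorem evalAtPoint_mk (f : MvPolynomial σ k) (m : ℕ) (F : MvPolynomial (DegIdx σ m) k) :
    evalAtPoint f m (Ideal.Quotient.mk (orbitVanishingIdeal f m) F) = aeval (formCoeff m f) F :=
  rfl

omit [Fintype σ] in
/-- If `γ · f = c • f` with `f ≠ 0` then `c ≠ 0`. [folklore] -/
private theorem ne_zero_of_linSubstRep_eq_smul [Fintype σ] {γ : GL σ k} {f : MvPolynomial σ k} {c : k}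
    (hf : f ≠ 0) (h : linSubstRep σ k γ f = c • f) : c ≠ 0 := by
  rintro rfl
  rw [zero_smul] at h
  apply hf
  have : linSubstRep σ k γ⁻¹ (linSubstRep σ k γ f) = f := by
    rw [← Module.End.mul_apply, ← map_mul, inv_mul_cancel, map_one, Module.End.one_apply]
  rw [← this, h, map_zero]

/-- If `γ · f = c • f`, `c ≠ 0`, then `γ⁻¹ · f = c⁻¹ • f`. [folklore] -/
private theorem linSubstRep_inv_eq_smul {γ : GL σ k} {f : MvPolynomial σ k} {c : k} (hc : c ≠ 0)
    (h : linSubstRep σ k γ f = c • f) : linSubstRep σ k γ⁻¹ f = c⁻¹ • f := by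
  have h1 : linSubstRep σ k γ⁻¹ (linSubstRep σ k γ f) = f := by
    rw [← Module.End.mul_apply, ← map_mul, inv_mul_cancel, map_one, Module.End.one_apply]
  rw [h, map_smul] at h1
  calc linSubstRep σ k γ⁻¹ f = c⁻¹ • (c • linSubstRep σ k γ⁻¹ f) := by
        rw [smul_smul, inv_mul_cancel₀ hc, one_smul]
    _ = c⁻¹ • f := by rw [h1]

/-- **Prop. 4.2, the computation** (Mulmuley–Sohoni 2008 `[L1041–1049, L1069–1073]`): on the
degree-`d` piece `k[Δ[f]]_d`, evaluation at `f̂` transforms under an element `γ` of the stabilizer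
`G_f` of the LINE through `f` (`γ · f = c • f`) by the character `c ↦ c^{-d}`:
`ev(γ · x) = c^{-d} ev(x)` — i.e. `ev` spans a copy of the `G_f`-module `((k f)^{⊗d})` inside
the dual of any `G`-submodule of `k[Δ[f]]_d` on which it does not vanish ("the dual map `φ`
injects the `G_h`-module `ℂh^d` into `S^*`"). Tree convention `(γ · F)(v) = F(γ⁻¹ · v)`
(`coordRep`). [cite: MulmuleySohoniGCT2SIAM2008, Prop. 4.2 (arXiv cs/0612134 Prop. 5.2, main.tex L1041–1077)] -/
theorem evalAtPoint_orbitCoordRep_of_eq_smul {f : MvPolynomial σ k} {m d : ℕ} {γ : GL σ k}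
    {c : k} (hc : c ≠ 0) (hγ : linSubstRep σ k γ f = c • f) {x : OrbitCoordRing f m}
    (hx : x ∈ orbitCoordRingDeg f m d) :
    evalAtPoint f m (orbitCoordRep f m γ x) = (c⁻¹) ^ d * evalAtPoint f m x := by
  obtain ⟨F, hF, rfl⟩ := mem_orbitCoordRingDeg_iff.mp hx
  rw [orbitCoordRep_apply, orbitCoordSubst_mk, evalAtPoint_mk, evalAtPoint_mk,
    aeval_formCoeff_coordSubst, linSubstRep_inv_eq_smul hc hγ, formCoeff_smul]
  exact Literature.RingTheory.MvPolynomial.eval_smul_of_isHomogeneous hF _ _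

/-- **`G · [f] = GL · [f]` in `P(V)`**: every `GL`-translate of `f` is a scalar multiple of a
`G`-translate. This is the (only) property of MS's acting group `G = SL(Y) ≤ Ĝ = GL(Y)` used in
Prop. 4.2 ("the cone of the affine `G`-orbit of `h` is dense in `Δ̌[h]`" `[L1064–1066]`); it holds
for `G = GL` trivially and for `G = SL` over an algebraically closed field
(`hasFullProjectiveOrbit_slSubgroup`). [cite: MulmuleySohoniGCT2SIAM2008, Prop. 4.2 proof (arXiv cs/0612134 Prop. 5.2, main.tex L1060–1067)] -/
def HasFullProjectiveOrbit (G : Subgroup (GL σ k)) (f : MvPolynomial σ k) : Prop :=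
  ∀ γ : GL σ k, ∃ c : k, ∃ γ' ∈ G, linSubstRep σ k γ f = c • linSubstRep σ k γ' f

/-- `Ĝ · [f] = GL · [f]` for MS's `Ĝ = GL(Y)` itself (trivial instance of `HasFullProjectiveOrbit`).
[cite: MulmuleySohoniGCT2SIAM2008, §2 (the groups G = SL(Y), Ĝ = GL(Y), main.tex L693–697)] -/
theorem hasFullProjectiveOrbit_top (f : MvPolynomial σ k) : HasFullProjectiveOrbit ⊤ f :=
  fun γ => ⟨1, γ, Subgroup.mem_top γ, (one_smul _ _).symm⟩

omit [Fintype σ] [DecidableEq σ] in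
/-- Homogeneous polynomials are eigenvectors of the scalar substitution `X i ↦ c • X i` (any
field; the tree's `aeval_smul_X_of_isHomogeneous` is the case `k = ℂ`). [folklore] -/
private theorem aeval_smul_X_eq_pow_smul {f : MvPolynomial σ k} {m : ℕ} (hf : f.IsHomogeneous m)
    (c : k) : aeval (fun i => c • (X i : MvPolynomial σ k)) f = c ^ m • f := by
  conv_lhs => rw [f.as_sum]
  conv_rhs => rw [f.as_sum]
  rw [map_sum, Finset.smul_sum]
  refine Finset.sum_congr rfl fun d hd => ?_
  have hdeg : d.degree = m := by
    have := hf (mem_support_iff.mp hd)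
    rw [Finsupp.degree_eq_weight_one]
    exact this
  rw [aeval_monomial, monomial_eq, Algebra.algebraMap_eq_smul_one, smul_mul_assoc, one_mul,
    smul_eq_C_mul, smul_eq_C_mul, ← mul_assoc, ← map_mul, mul_comm (c ^ m)]
  rw [map_mul, mul_assoc]
  congr 1
  rw [Finsupp.prod, Finsupp.prod]
  have : ∀ i ∈ d.support, (c • (X i : MvPolynomial σ k)) ^ d i = C (c ^ d i) * X i ^ d i := by
    intro i _
    rw [smul_eq_C_mul, mul_pow, ← map_pow]
  rw [Finset.prod_congr rfl this, Finset.prod_mul_distrib, ← map_prod, Finset.prod_pow_eq_pow_sum,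
    ← Finsupp.degree_apply, hdeg]

/-- Scalar matrices act on forms of degree `m` by `c ^ m`: `(c • A) · f = c ^ m • (A · f)` (any
field). [folklore] -/
private theorem linSubst_smul_eq_pow_smul {f : MvPolynomial σ k} {m : ℕ} (hf : f.IsHomogeneous m)
    (c : k) (A : Matrix σ σ k) : linSubst σ k (c • A) f = c ^ m • linSubst σ k A f := by
  have h1 : c • A = A * (c • (1 : Matrix σ σ k)) := by rw [Matrix.mul_smul, Matrix.mul_one]
  rw [h1, linSubst_mul, AlgHom.comp_apply]
  have h2 : linSubst σ k (c • (1 : Matrix σ σ k)) f = c ^ m • f := by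
    rw [Matrix.smul_one_eq_diagonal]
    have : linSubst σ k (Matrix.diagonal fun _ : σ => c) =
        aeval fun i => c • (X i : MvPolynomial σ k) :=
      MvPolynomial.algHom_ext fun i => by rw [Grenet.linSubst_diagonal_X, aeval_X]
    rw [this]
    exact aeval_smul_X_eq_pow_smul hf c
  rw [h2, map_smul]

/-- **`SL · [f] = GL · [f]`** over an algebraically closed field, for a form `f` of degree `m`:
rescale `γ ∈ GL` by an `N`-th root of `det γ` (`N = |σ|`). This is why MS may pass between
`G = SL(Y)` and `Ĝ = GL(Y)` (§2 `[L695–697]`, Thm. 2.3 "as well as `Ĝ = GL(Y)`").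
[cite: MulmuleySohoniGCT2SIAM2008, §2 (the groups G = SL(Y), Ĝ = GL(Y), main.tex L693–697)] -/
theorem hasFullProjectiveOrbit_slSubgroup [IsAlgClosed k] {f : MvPolynomial σ k} {m : ℕ}
    (hf : f.IsHomogeneous m) : HasFullProjectiveOrbit (slSubgroup σ k) f := by
  intro γ
  rcases Nat.eq_zero_or_pos (Fintype.card σ) with h0 | hpos
  · haveI : IsEmpty σ := Fintype.card_eq_zero_iff.mp h0
    refine ⟨1, γ, mem_slSubgroup_iff.mpr (Matrix.det_isEmpty), (one_smul _ _).symm⟩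
  · obtain ⟨r, hr⟩ := IsAlgClosed.exists_pow_nat_eq ((γ : Matrix σ σ k).det) hpos
    have hdet : (γ : Matrix σ σ k).det ≠ 0 := Matrix.GeneralLinearGroup.det_ne_zero γ
    have hr0 : r ≠ 0 := by
      rintro rfl
      rw [zero_pow hpos.ne'] at hr
      exact hdet hr.symm
    set A : Matrix σ σ k := r⁻¹ • (γ : Matrix σ σ k) with hA
    have hAdet : A.det = 1 := by
      rw [hA, Matrix.det_smul, ← hr, inv_pow, inv_mul_cancel₀ (pow_ne_zero _ hr0)]
    refine ⟨r ^ m, Matrix.SpecialLinearGroup.toGL ⟨A, hAdet⟩, ⟨⟨A, hAdet⟩, rfl⟩, ?_⟩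
    have hγA : (γ : Matrix σ σ k) = r • A := by
      rw [hA, smul_smul, mul_inv_cancel₀ hr0, one_smul]
    rw [linSubstRep_apply, linSubstRep_apply, hγA, linSubst_smul_eq_pow_smul hf]
    rfl

/-- **Prop. 4.2, the non-vanishing** (Mulmuley–Sohoni 2008 `[L1060–1067]`: "Not all functions in
`S` can vanish at `ĥ`: Otherwise, they will vanish identically on the `G`-orbit of `ĥ` … and so
also on its cone, since the functions in `S` are homogeneous … Hence … the functions in `S` vanish
on `Δ̌[h]` identically; a contradiction"): if `W ≠ 0` is a `G`-stable subspace of `k[Δ[f]]_d` and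
`G · [f] = GL · [f]` (`HasFullProjectiveOrbit`, e.g. `G = GL`, or `G = SL` over an algebraically
closed field), then evaluation at `f̂` does not vanish on `W`.
[cite: MulmuleySohoniGCT2SIAM2008, Prop. 4.2 (arXiv cs/0612134 Prop. 5.2, main.tex L1041–1067)] -/
theorem exists_evalAtPoint_ne_zero {G : Subgroup (GL σ k)} {f : MvPolynomial σ k} {m d : ℕ}
    (hG : HasFullProjectiveOrbit G f) {W : Submodule k (OrbitCoordRing f m)}
    (hWd : W ≤ orbitCoordRingDeg f m d) (hWG : ∀ γ ∈ G, ∀ x ∈ W, orbitCoordRep f m γ x ∈ W)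
    (hW : W ≠ ⊥) : ∃ x ∈ W, evalAtPoint f m x ≠ 0 := by
  by_contra hcon
  push Not at hcon
  apply hW
  rw [Submodule.eq_bot_iff]
  intro x hx
  obtain ⟨F, hF, rfl⟩ := mem_orbitCoordRingDeg_iff.mp (hWd hx)
  refine Ideal.Quotient.eq_zero_iff_mem.mpr (mem_orbitVanishingIdeal_iff.mpr fun γ => ?_)
  obtain ⟨c, γ', hγ', hγ⟩ := hG γ
  have h1 : aeval (formCoeff m (linSubstRep σ k γ' f)) F = 0 := by
    have h2 := hcon _ (hWG _ (inv_mem hγ') _ hx)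
    rwa [orbitCoordRep_apply, orbitCoordSubst_mk, evalAtPoint_mk, aeval_formCoeff_coordSubst,
      inv_inv] at h2
  rw [hγ, formCoeff_smul]
  change eval (c • formCoeff m (linSubstRep σ k γ' f)) F = 0
  rw [Literature.RingTheory.MvPolynomial.eval_smul_of_isHomogeneous hF]
  change c ^ d * aeval (formCoeff m (linSubstRep σ k γ' f)) F = 0
  rw [h1, mul_zero]

/-- **Prop. 4.2, conclusion "`S^*` is `G_ĥ`-admissible"** `[L1046–1047]`: every nonzero `G`-stable
subspace `W` of `k[Δ[f]]_d` (with `G · [f] = GL · [f]`) is dually admissible for the stabilizer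
`G ∩ G_f̂` — the restriction of evaluation at `f̂` is a nonzero invariant functional. (MS's
further conclusion "`S` is `G_ĥ`-admissible" needs `G_ĥ` reductive and Weyl's complete
reducibility `[L1109–1113]`, Prop. 5.1; not formalised.)
[cite: MulmuleySohoniGCT2SIAM2008, Prop. 4.2 and Prop. 5.1 (arXiv cs/0612134 Props. 5.2, 6.1, main.tex L1041–1113)] -/
theorem isDualAdmissible_stabilizer_of_subrepresentation {G : Subgroup (GL σ k)}
    {f : MvPolynomial σ k} {m d : ℕ} (hG : HasFullProjectiveOrbit G f)
    (W : Subrepresentation (orbitCoordRep f m)) (hWd : W.toSubmodule ≤ orbitCoordRingDeg f m d)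
    (hW : W.toSubmodule ≠ ⊥) :
    IsDualAdmissible (G ⊓ linStabilizer f) W.toRepresentation := by
  obtain ⟨x, hx, hne⟩ := exists_evalAtPoint_ne_zero (d := d) hG hWd
    (fun γ _ x hx => W.apply_mem_toSubmodule γ hx) hW
  refine ⟨(evalAtPoint f m).toLinearMap ∘ₗ W.toSubmodule.subtype, ?_, ?_⟩
  · intro h0
    apply hne
    have := LinearMap.congr_fun h0 ⟨x, hx⟩
    simpa using this
  · intro γ hγ
    apply LinearMap.ext
    intro y
    have hγf : linSubstRep σ k γ f = (1 : k) • f := by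
      rw [one_smul]; exact mem_linStabilizer.mp (Subgroup.mem_inf.mp hγ).2
    have := evalAtPoint_orbitCoordRep_of_eq_smul one_ne_zero hγf (hWd y.2)
    rw [inv_one, one_pow, one_mul] at this
    change evalAtPoint f m (orbitCoordRep f m γ (y : OrbitCoordRing f m)) =
      evalAtPoint f m (y : OrbitCoordRing f m)
    exact this

/-- A linear functional `φ` on a `GL`-representation **transforms like evaluation at `f̂^d`** under
the stabilizer in `G` of the line through `f`: `φ(γ · w) = c^{-d} φ(w)` whenever `γ ∈ G`,
`γ · f = c • f`. A nonzero such `φ ∈ S^*` spans exactly "a `G_f`-module isomorphic to `(ℂf)^d`"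
in `S^*` (Mulmuley–Sohoni 2008, Def. 1.3 (2) `[L327–329]` and Prop. 4.2), with the tree's
convention `(γ · F)(v) = F(γ⁻¹ v)` (see `evalAtPoint_orbitCoordRep_of_eq_smul`).
[cite: MulmuleySohoniGCT2SIAM2008, Def. 1.3 and Prop. 4.2 (arXiv cs/0612134 Def. 2.3, main.tex L323–333)] -/
def IsEvalSemiInvariant (G : Subgroup (GL σ k)) (f : MvPolynomial σ k) (d : ℕ) {V : Type*}
    [AddCommGroup V] [Module k V] (ρ : Representation k (GL σ k) V) (φ : V →ₗ[k] k) : Prop :=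
  ∀ γ ∈ G, ∀ c : k, linSubstRep σ k γ f = c • f → φ ∘ₗ ρ γ = (c⁻¹) ^ d • φ

/-- **Strong obstruction** (Mulmuley–Sohoni 2008, Def. 1.3 `[tex:cs_0612134 main.tex L323–333]`:
"We say that `S` is a *strong obstruction* if, for some `d`, (1) it occurs in `R_V[f]_d`, (2) but
its dual `S^*` does not contain a `G_g`-module isomorphic to `(ℂ g)^d`"), in degree `d`, with the
tree's argument order of `HasOccurrenceObstruction` (`GCTObstructions.lean`): FIRST argument `f` =
MS's `g` (the point whose orbit closure should not contain the other, e.g. `det_m`), SECOND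
argument `g` = MS's `f` (the point to be excluded, e.g. the padded permanent). So: some
irreducible `GL`-subrepresentation `S` of `k[Δ[g]]` inside the degree-`d` piece (condition (1))
admits no nonzero functional transforming like evaluation at `f̂^d` under the stabilizer of `[f]`
in `G` (condition (2), `IsEvalSemiInvariant`). `G` is MS's acting group (`slSubgroup` for
`G = SL(Y)`, `⊤` for `Ĝ`); `S` is taken `GL`-stable as in `HasOccurrenceObstruction` (for
`G = SL` over `ℂ` the `G`-submodules of a fixed degree piece are the `GL`-submodules, scalars acting
by `t^{-dm}`). [cite: MulmuleySohoniGCT2SIAM2008, Def. 1.3 (arXiv cs/0612134 Def. 2.3, main.tex L323–333)] -/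
def HasStrongObstruction (G : Subgroup (GL σ k)) (f g : MvPolynomial σ k) (m d : ℕ) : Prop :=
  ∃ W : Subrepresentation (orbitCoordRep g m), W.toSubmodule ≤ orbitCoordRingDeg g m d ∧
    W.toRepresentation.IsIrreducible ∧
      ∀ φ : W.toSubmodule →ₗ[k] k, IsEvalSemiInvariant G f d W.toRepresentation φ → φ = 0

/-- **"A strong obstruction is also an obstruction"** (Mulmuley–Sohoni 2008, §1 `[L332]`, via
Prop. 4.2 `[L316–320]`: "If `S` occurs in `R_V[g]_d`, then … its dual `S^*` contains a `G_g`-module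
isomorphic to `(ℂ g)^d`"): for `f ≠ 0` with `G · [f] = GL · [f]` (`HasFullProjectiveOrbit`; always
for `G = GL`, and for `G = SL` over `ℂ`), a strong obstruction in degree `d` is an occurrence
obstruction in degree `d` (`HasOccurrenceObstruction`): a nonzero intertwiner `S → k[Δ[f]]_d` would
pull evaluation at `f̂` back to a nonzero functional on `S` transforming like `f̂^d`.
[cite: MulmuleySohoniGCT2SIAM2008, §1 after Def. 1.3 (main.tex L316–332) with Prop. 4.2] -/
theorem HasStrongObstruction.hasOccurrenceObstruction {G : Subgroup (GL σ k)}
    {f g : MvPolynomial σ k} {m d : ℕ} (hf0 : f ≠ 0) (hG : HasFullProjectiveOrbit G f)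
    (h : HasStrongObstruction G f g m d) : HasOccurrenceObstruction f g m d := by
  obtain ⟨W, hWd, hirr, hφ⟩ := h
  refine ⟨W, hWd, hirr, fun ψ => ?_⟩
  -- the pulled-back evaluation functional is semi-invariant, hence zero
  set φ : W.toSubmodule →ₗ[k] k :=
    (evalAtPoint f m).toLinearMap ∘ₗ (orbitCoordRingDeg f m d).subtype ∘ₗ ψ.toLinearMap with hφdef
  have hφsemi : IsEvalSemiInvariant G f d W.toRepresentation φ := by
    intro γ hγ c hc
    apply LinearMap.ext
    intro w
    have hc0 : c ≠ 0 := ne_zero_of_linSubstRep_eq_smul hf0 hc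
    simp only [hφdef, LinearMap.coe_comp, Function.comp_apply, LinearMap.smul_apply,
      AlgHom.toLinearMap_apply, Submodule.subtype_apply, IntertwiningMap.toLinearMap_apply]
    rw [IntertwiningMap.isIntertwining _ _ ψ γ w, orbitCoordRepDeg_apply_coe,
      evalAtPoint_orbitCoordRep_of_eq_smul hc0 hc (ψ w).2, smul_eq_mul]
  have hφ0 : φ = 0 := hφ φ hφsemi
  -- so evaluation vanishes on the `G`-stable image of `ψ`, which is therefore zero
  set W' : Submodule k (OrbitCoordRing f m) :=
    (LinearMap.range ψ.toLinearMap).map (orbitCoordRingDeg f m d).subtype with hW'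
  have hW'd : W' ≤ orbitCoordRingDeg f m d := by
    rintro _ ⟨y, _, rfl⟩
    exact y.2
  have hW'G : ∀ γ ∈ G, ∀ x ∈ W', orbitCoordRep f m γ x ∈ W' := by
    rintro γ _ _ ⟨y, ⟨w, rfl⟩, rfl⟩
    refine ⟨orbitCoordRepDeg f m d γ (ψ w), ⟨W.toRepresentation γ w, ?_⟩, rfl⟩
    rw [IntertwiningMap.toLinearMap_apply, IntertwiningMap.isIntertwining _ _ ψ γ w]
  have hW'bot : W' = ⊥ := by
    by_contra hne
    obtain ⟨x, hx, hx0⟩ := exists_evalAtPoint_ne_zero hG hW'd hW'G hne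
    obtain ⟨y, ⟨w, rfl⟩, rfl⟩ := hx
    apply hx0
    have := LinearMap.congr_fun hφ0 w
    rw [LinearMap.zero_apply] at this
    exact this
  apply IntertwiningMap.ext
  apply LinearMap.ext
  intro w
  have hmem : ((ψ w : orbitCoordRingDeg f m d) : OrbitCoordRing f m) ∈ W' :=
    ⟨ψ w, ⟨w, rfl⟩, rfl⟩
  rw [hW'bot, Submodule.mem_bot] at hmem
  rw [IntertwiningMap.toLinearMap_apply, IntertwiningMap.zero_toLinearMap, LinearMap.zero_apply]
  exact Subtype.ext hmem

/-- Over `ℂ`, for forms `f ≠ 0`, `g` of degree `m` and `G · [f] = GL · [f]`: **a strong obstruction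
separates** — `g ∉ Δ[f]` ("Existence of such an `S` implies that `f` cannot lie in `Δ_V[g]`",
`[L312–313]`, with `[L332]`): strong ⇒ occurrence ⇒ multiplicity obstruction ⇒ the obstruction
principle `not_hasMultiplicityObstruction_of_mem_orbitClosure`.
[cite: MulmuleySohoniGCT2SIAM2008, §1 (main.tex L291–313, L332)] -/
theorem HasStrongObstruction.not_mem_orbitClosure {σ : Type} [Fintype σ] [DecidableEq σ]
    {G : Subgroup (GL σ ℂ)} {f g : MvPolynomial σ ℂ} {m d : ℕ} (hf0 : f ≠ 0)
    (hG : HasFullProjectiveOrbit G f) (hf : f.IsHomogeneous m) (hg : g.IsHomogeneous m)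
    (h : HasStrongObstruction G f g m d) : g ∉ orbitClosure f := fun hmem =>
  not_hasMultiplicityObstruction_of_mem_orbitClosure hmem d
    (hasMultiplicityObstruction_of_hasOccurrenceObstruction_complex_holds hf hg
      (h.hasOccurrenceObstruction hf0 hG))

/-- The generic determinant is nonzero (Mathlib's `Matrix.det_mvPolynomialX_ne_zero`). [folklore] -/
private theorem detPoly_ne_zero' (m : ℕ) : detPoly (Fin m) ℂ ≠ 0 :=
  Matrix.det_mvPolynomialX_ne_zero (Fin m) ℂ

/-- Consequence of §3 for Def. 1.3: **no strong obstruction** (for `G = SL_{m²}(ℂ)` or `GL_{m²}(ℂ)`,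
indeed any `G` with `G · [det_m] = GL · [det_m]`) against the padded permanent lying in
`Δ(det_m)` exists in any degree once `m ≥ 2^n - 1`, `n ≥ 1`.
[cite: MulmuleySohoniGCT2SIAM2008, §3 with Def. 1.3 (main.tex L899–911, L323–333)] -/
theorem not_hasStrongObstruction_of_two_pow_le {n m : ℕ} [NeZero m] {G : Subgroup (GL (Fin m × Fin m) ℂ)}
    (hG : HasFullProjectiveOrbit G (detPoly (Fin m) ℂ)) (hn : 1 ≤ n) (hm : 2 ^ n ≤ m + 1) (d : ℕ) :
    ¬ HasStrongObstruction G (detPoly (Fin m) ℂ) (paddedPerPoly ℂ n m) m d := fun h =>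
  not_hasOccurrenceObstruction_of_two_pow_le hn hm d
    (h.hasOccurrenceObstruction (detPoly_ne_zero' m) hG)

/-- **Status of Conj. 3.2 in the range of Bürgisser–Ikenmeyer–Panova** (Mulmuley–Sohoni 2008,
Conj. 3.2 `[tex:cs_0612134 main.tex L954–958]`: "There exist (infinitely many) strong obstructions
for `(f,g) = (φ(h),g)`, `g = det(Y)`, `h = perm(X)`, if `m = 2^{log^c n}`, `c` a constant, and
`n → ∞`"): by "a strong obstruction is also an obstruction"
(`HasStrongObstruction.hasOccurrenceObstruction`) and Bürgisser–Ikenmeyer–Panova 2019, Thm. 1.4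
in the tree's fresh-variable form (`bip_no_occurrence_obstruction_succ_holds`: no occurrence
obstruction against `X₀₀^{m-n} per_n ∈ Δ(det_m)` for `m ≥ (n+1)^25`), there is NO strong
obstruction in the sense of Def. 1.3 — for `G = Ĝ = GL_{m²}`, for `G = SL_{m²}(ℂ)`
(`hasFullProjectiveOrbit_slSubgroup`), indeed for any `G` with `G · [det_m] = GL · [det_m]` — in any
degree `d ≥ 1`, whenever `n ≥ 1` and `m ≥ (n+1)^25`; since `2^{(log₂ n)^c} ≥ (n+1)^25` for all large
`n` when `c > 1`, the printed conjecture fails in its own window for every `c > 1` (the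
multiplicity reading is the registered open hypothesis `GCTMultiplicityObstructionsQP`). This is a
consequence of BIP's theorem and of `[L332]`, not a statement printed in GCT II.
[cite: BurgisserIkenmeyerPanovaJAMS2019, Thm. 1.4 (with Mulmuley–Sohoni 2008 Def. 1.3 and main.tex L332)] -/
theorem not_hasStrongObstruction_of_bip {n m : ℕ} [NeZero m] {G : Subgroup (GL (Fin m × Fin m) ℂ)}
    (hG : HasFullProjectiveOrbit G (detPoly (Fin m) ℂ)) (hn : 1 ≤ n) {d : ℕ} (hd : 1 ≤ d)
    (hm : (n + 1) ^ 25 ≤ m) :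
    ¬ HasStrongObstruction G (detPoly (Fin m) ℂ) (paddedPerPoly ℂ n m) m d := fun h =>
  bip_no_occurrence_obstruction_succ_holds n m d hn hd hm
    (h.hasOccurrenceObstruction (detPoly_ne_zero' m) hG)

end Evaluation

/-! ## §5 / Thm. 1.8 (a): Borel–Weil for orbit closures of stable points `[L478–497, L1099–1174]` -/

section BorelWeil

open Literature.NumberTheory.DiophantineGeometry in
/-- **Mulmuley–Sohoni 2008, Thm. 1.8 (a)** `[tex:cs_0612134 main.tex L478–487]` ("(Borel–Weil for
orbit closures of partially stable points) Let `V` be a (finite dimensional) linear representation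
of a connected, reductive `G`. (a) If `v ∈ P(V)` is stable, an irreducible `G`-module `V_λ(G)`
with weight `λ` can occur in `R_V[v]` iff `V_λ(G)` is `G_v̂`-admissible"), i.e. Props. 5.1–5.2
`[L1099–1174]` (proof in print: Matsushima — `G_v̂` is reductive for stable `v`; the algebraic
Peter–Weyl theorem `ℂ[G/H] = ⊕_S S ⊗ (S^*)^H`; closedness of `G v̂` in `Δ̌[v]`), TYPED IN THE
SPECIAL CASE the tree speaks: `G = SL_σ(ℂ)` (`slSubgroup σ ℂ`, `σ` a finite ordered index
type, e.g. `Fin N` or the matrix positions) acting on `V = Sym^m(ℂ^σ)` by linear substitution, `v` a nonzero polystable form of degree `m > 0`, `R_V[v] = ⊕_d ℂ[Δ[v]]_d`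
(`orbitCoordRepDeg`), and the irreducible `G`-module given as an `SL_σ`-irreducible RATIONAL
representation `ρ` of `GL_σ(ℂ)` (every irreducible rational `SL`-module is of this form); "occurs in
`R_V[v]`" = a nonzero `SL_σ`-intertwiner into some degree piece; "`G_v̂`-admissible" =
`IsAdmissible ρ (slSubgroup ⊓ linStabilizer v)` (Def. 4.1; the tree's decl from
`BLMW11StabilityInheritance.lean`). -- TODO(general form): arbitrary
connected reductive `G` and representation `V` (no algebraic groups in Mathlib); part (b)
(partially stable, defect zero; Thms. 7.x–8.2) is in the companion file for §6–§12. NAMED FACT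
(D-0014): the printed proof needs Matsushima's criterion and algebraic Peter–Weyl for `SL_N(ℂ)`,
absent from Mathlib and the tree. The "⇒" half in DUAL form is proved in this file
(`isDualAdmissible_stabilizer_of_subrepresentation`).
[cite: MulmuleySohoniGCT2SIAM2008, Thm. 1.8 (a) with Props. 5.1–5.2 (arXiv cs/0612134 Thm. 2.8 (a), Props. 6.1–6.2; main.tex L478–487, L1099–1174)] -/
def MS08_thm_1_8a : Prop :=
  ∀ {σ : Type} [Fintype σ] [LinearOrder σ] (v : MvPolynomial σ ℂ) {m : ℕ} (_ : 0 < m)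
    (_ : v.IsHomogeneous m) (_ : v ≠ 0) (_ : IsPolystable v)
    {V : Type} [AddCommGroup V] [Module ℂ V] [FiniteDimensional ℂ V]
    (ρ : Representation ℂ (GL σ ℂ) V) (_ : IsRationalRep ρ)
    (_ : Representation.IsIrreducible (ρ.comp (slSubgroup σ ℂ).subtype)),
    (∃ d : ℕ, ∃ ψ : IntertwiningMap (ρ.comp (slSubgroup σ ℂ).subtype)
        ((orbitCoordRepDeg v m d).comp (slSubgroup σ ℂ).subtype), ψ ≠ 0) ↔
      IsAdmissible ρ (slSubgroup σ ℂ ⊓ linStabilizer v)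

open Literature.NumberTheory.DiophantineGeometry in
/-- **Prop. 5.2** `[L1119–1123]` ("Suppose `h ∈ P(V)` is stable. Then every `H`-admissible,
irreducible `G`-module occurs in `R[h]`", `H = G_ĥ`) — the "⇐" half of Thm. 1.8 (a), as a proved
projection of the named fact `MS08_thm_1_8a` (same special case).
[cite: MulmuleySohoniGCT2SIAM2008, Prop. 5.2 (arXiv cs/0612134 Prop. 6.2, main.tex L1119–1174)] -/
theorem MS08_prop_5_2_of_thm_1_8a (h18 : MS08_thm_1_8a) {σ : Type} [Fintype σ] [LinearOrder σ]
    (v : MvPolynomial σ ℂ) {m : ℕ} (hm : 0 < m) (hv : v.IsHomogeneous m) (hv0 : v ≠ 0)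
    (hst : IsPolystable v) {V : Type} [AddCommGroup V] [Module ℂ V] [FiniteDimensional ℂ V]
    (ρ : Representation ℂ (GL σ ℂ) V) (hρ : IsRationalRep ρ)
    (hirr : Representation.IsIrreducible (ρ.comp (slSubgroup σ ℂ).subtype))
    (hadm : IsAdmissible ρ (slSubgroup σ ℂ ⊓ linStabilizer v)) :
    ∃ d : ℕ, ∃ ψ : IntertwiningMap (ρ.comp (slSubgroup σ ℂ).subtype)
        ((orbitCoordRepDeg v m d).comp (slSubgroup σ ℂ).subtype), ψ ≠ 0 :=
  (h18 v hm hv hv0 hst ρ hρ hirr).mpr hadm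

end BorelWeil

end Literature.Computability.AlgebraicComplexity

end
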